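import Summits.Ventures.PercRepro.ProfilePointedCircuitClassesStarNineSerC
import Summits.Ventures.PercRepro.ProfilePointedCircuitClassesStarSharpAsmA

/-!
# PercRepro — `StarNine` REDUCES TO SIMPLE COSIMPLE MATROIDS
(p5, gen 57; `proofs/P5-GM1.md` §85)

(★)₉ is a theorem on every coloop-free nine-point rank-5 matroid that has a loop (no bi-independent set at all),
a parallel pair (`starNine_of_parallel`, the parallel-pair regime) or a series pair (every position of `e, f`, with
or without a series triple: `starNine_of_seriesPair_all`).  `starNine_of_not_simple_cosimple` collects the three:
what is left of `StarNine` is the SIMPLE COSIMPLE core — no loop, no parallel pair, no coloop, no series pair.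
-/

open scoped Matroid

namespace PercRepro.Cogirth

open Finset ThmH Skew Shadow Profile

open Classical

variable {α : Type} [DecidableEq α] {N : Matroid α} [N.Finite]

section StarNineReduce

/-- **(★)₉ WITH A LOOP**: every count vanishes. -/
theorem starNine_of_loop {x : α} (hx : x ∈ gr N) (hx0 : rk N {x} = 0) (e f : α) :
    inCount N 4 e ≤ inCount N 4 f + thruCount N 4 {e, f} := by
  unfold inCount thruCount
  rw [biIndepSets_eq_empty_of_loop_pt hx hx0 4, filter_empty, filter_empty, filter_empty, card_empty]

/-- **THE SERIES-PAIR REGIME OF `StarNine`, EVERY POSITION**: on every coloop-free matroid with `#E = 9`,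
`ρ(E) = 5` and a series pair `{b, b′}`, `in_4(e) ≤ in_4(f) + thru_4({e, f})` for all `e ≠ f` — a series triple
through the pair by `starNine_of_seriesTriple`, otherwise the four positions of `{e, f}` relative to the pair. -/
theorem starNine_of_seriesPair_all (hn : (gr N).card = 9) (hR : rk N (gr N) = 5)
    (hcf : ∀ x ∈ gr N, rk N ((gr N).erase x) = 5) {b b' : α} (h : SeriesPair N b b') {e f : α}
    (he : e ∈ gr N) (hf : f ∈ gr N) (hef : e ≠ f) :
    inCount N 4 e ≤ inCount N 4 f + thruCount N 4 {e, f} := by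
  have hn4 : (gr N).card = rk N (gr N) + 4 := by omega
  by_cases htri : ∃ x ∈ gr N, x ≠ b ∧ x ≠ b' ∧ (SeriesPair N b' x ∨ SeriesPair N b x)
  · obtain ⟨x, _, hxb, hxb', hpair⟩ := htri
    rcases hpair with hp | hp
    · exact starNine_of_seriesTriple hn hR h hp hxb.symm he hf hef
    · exact starNine_of_seriesTriple hn hR h.symm hp hxb'.symm he hf hef
  · have hno : ∀ x ∈ gr N, x ≠ b → ¬ SeriesPair N b' x := by
      intro x hx hxb hp
      by_cases hxb' : x = b'
      · subst hxb'
        exact hp.2.2.1 rfl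
      · exact htri ⟨x, hx, hxb, hxb', Or.inl hp⟩
    have hno' : ∀ x ∈ gr N, x ≠ b' → ¬ SeriesPair N b x := by
      intro x hx hxb' hp
      by_cases hxb : x = b
      · subst hxb
        exact hp.2.2.1 rfl
      · exact htri ⟨x, hx, hxb, hxb', Or.inr hp⟩
    by_cases heb : e = b
    · subst heb
      by_cases hfb' : f = b'
      · subst hfb'
        exact starNine_of_seriesPair_self hn4 h
      · exact starNine_of_seriesPair_left hn hR hcf h hno hf hef.symm hfb'
    by_cases heb' : e = b'
    · subst heb'
      by_cases hfb : f = b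
      · subst hfb
        exact starNine_of_seriesPair_self hn4 h.symm
      · exact starNine_of_seriesPair_left hn hR hcf h.symm hno' hf hef.symm hfb
    by_cases hfb : f = b
    · subst hfb
      exact starNine_of_seriesPair_right hn hR h he heb heb'
    by_cases hfb' : f = b'
    · subst hfb'
      exact starNine_of_seriesPair_right hn hR h.symm he heb' heb
    exact starNine_of_seriesPair hn hR hcf h hno he hf hef heb heb' hfb hfb'

/-- **`StarNine` OFF THE SIMPLE COSIMPLE CORE**: on every coloop-free matroid with `#E = 9`, `ρ(E) = 5` that has a
loop, a parallel pair or a series pair, `in_4(e) ≤ in_4(f) + thru_4({e, f})` for all `e ≠ f`. -/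
theorem starNine_of_not_simple_cosimple (hn : (gr N).card = 9) (hR : rk N (gr N) = 5)
    (hcf : ∀ x ∈ gr N, rk N ((gr N).erase x) = 5)
    (hstr : (∃ x ∈ gr N, rk N {x} = 0) ∨
      (∃ x ∈ gr N, ∃ x' ∈ gr N, x ≠ x' ∧ rk N {x} = 1 ∧ rk N {x'} = 1 ∧ x' ∈ clF N {x}) ∨
      (∃ b b' : α, SeriesPair N b b')) {e f : α} (he : e ∈ gr N) (hf : f ∈ gr N) (hef : e ≠ f) :
    inCount N 4 e ≤ inCount N 4 f + thruCount N 4 {e, f} := by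
  rcases hstr with ⟨x, hx, hx0⟩ | ⟨x, hx, x', hx', hxx', hrx, hrx', hcl⟩ | ⟨b, b', h⟩
  · exact starNine_of_loop hx hx0 e f
  · exact starNine_of_parallel hn hR hcf hx hx' hxx' hrx hrx' hcl he hf hef
  · exact starNine_of_seriesPair_all hn hR hcf h he hf hef

end StarNineReduce

end PercRepro.Cogirth
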